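import Summits.CriticalPhenomena.PercolationContinuityZ3.Theorems.Transplant.SkelPhiFaceRoute3N
import HarnessLib

/-!
# N1 ({±1} node), (F) inner route, part R3d (hp-8 g35): **THE ROUTE DATUM (h3) OF A FACE-STEP KIT FROM THE BRIDGE AND TWO BANDS —
# SERVED-FORM SEED CLEARANCE** (`faceRoute_of_bridge₄`)

This is `Skelφ.faceRoute_of_bridge₃` (p296018, `SkelPhiFaceRoute3N`) with ONE change of hypothesis shape, located as (L-F5)
(lane `prim-bschramm` 2026-08-22 01:15Z, refuter-confirmed 01:02:19Z): the seed clearances of the two BANDS are taken in the form the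
chain facts actually consume — per region, every vertex of the inner ball read into the region lies OFF the pinned seed `S`:
`hclear₂ : ∀ k ≤ S₂.N, ∀ w ∈ graphBall G c L, ψ₂ w ∈ S₂.region k → w ∉ S` (and `hclear₃` likewise) — instead of the α-only test
`kb < rootFrame φ c σ w 0` of `bridge₃`, which is undischargeable for the TANGENTIAL run of a y′-face (that run re-crosses the seed
column one band height above the contact, so it is clear of the seed zone in LEVEL, not in the α-projection).  The served form is
exactly the conclusion shape of the kit layer's region clearances (`Skelφ.xRun_region_clear_alpha/_level`,
`Skelφ.yRun_region_clear_alpha/_level`, p1 lineage), so either an α-reading or a level reading discharges it per region.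
The bridge segment keeps its α-clearance `hclear₁` (read against `hSk`).  Everything else — hop, bridge step, the two bands appended
along the cross links under hp-8 g24's route law, `linkIn_of_chainFacts` — is byte-identical to `bridge₃`.

builds on p205010 (kernel theorem, internal audit signed; external expert review pending) — nothing in this file uses p205010; nothing here is a
claim about the open node `SamePDropOfSkeletonNeg`.
Lane `prim-bschramm`, seat `prim-hp-8` (gen 35); helper file (`--supports stmt-CriticalPhenomena-4575 --as helper`).
* **`Skelφ.faceRoute_of_bridge₄`**.
[cite: KozmaNitzan2024, §4 Lemma 10 Step IV (pp. 20–21), Lemma 11 (pp. 22–23), Lemma 12 (pp. 23–25), p. 30 (Step III)]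
[cite: MartineauTassion2017, §3.2, §4.3 Lemma 4.2]
-/

noncomputable section

open MeasureTheory
open scoped Classical

namespace Summit.CriticalPhenomena.PercolationContinuityZ3.Theorems.Transplant

namespace Skelφ

open Literature.Probability.Percolation Literature.Probability.LatticeModels SimpleGraph KNLevels ChainPlanar
open Literature.Barriers.CriticalPhenomena (graphBall graphBall_mono mem_graphBall_self)
open Skel (winGraph routeW)

variable {V : Type} [DecidableEq V] [Countable V] {G : SimpleGraph V} [G.LocallyFinite] {φ ψc ψ₂ ψ₃ : V → Site 2}

/-- **THE ROUTE DATUM OF A FACE-STEP KIT FROM THE BRIDGE AND TWO BANDS, SERVED-FORM SEED CLEARANCE** (the bands' seed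
clearances `hclear₂`/`hclear₃` are taken per region as `w ∉ S` for every vertex of the inner ball read into the region; see the module
docstring for the roles of the other hypotheses, identical to `faceRoute_of_bridge₃`).
[cite: KozmaNitzan2024, §4 Lemma 10 Step IV (pp. 20–21), Lemma 11 (pp. 22–23), Lemma 12 (pp. 23–25)] -/
theorem faceRoute_of_bridge₄ (hlipφ : Lip G φ) (hlip₂ : Lip G ψ₂) (hlip₃ : Lip G ψ₃) {w₀ c : V} {Rπ L : ℕ} {Wt : Sym2 V → unitInterval}
    {q : unitInterval} {D T Z : Finset V} (hWG : ∀ e, e ∉ G.edgeSet → Wt e = 0) (hWD : IsSubbox (winGraph G w₀ Rπ) Wt q D)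
    (hDπ : ∀ u ∈ D, u ∈ graphBall G w₀ Rπ) (hcL : c ∈ graphBall G w₀ (Rπ - L)) (hLπ : L ≤ Rπ)
    -- the habitat and the target window of the face step, read in the cell map `ψc`
    {Pl : Finset (Site 2)} {MM : Finset V} (hPlD : Win G ψc w₀ Pl Rπ ⊆ D) (hMT : MM ⊆ T) (hMZ : Disjoint MM Z)
    -- the pinned seed
    {S : Finset V} (hcS : c ∈ S) (hSconn : ∀ s ∈ S, PathIn G (↑S : Set V) c s) (hSD : S ⊆ D) (hSL : ∀ s ∈ S, s ∈ graphBall G c L)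
    {σ : ℤ} (hσ : σ = 1 ∨ σ = -1) {kb : ℕ} (hSk : ∀ s ∈ S, |rootFrame φ c σ s 0| ≤ kb)
    -- the three frames and the chain data
    (B : BridgePrm) (hB : BridgeOK B) (S₂ S₃ : SchedFrame) (P₁ P₂ P₃ : WinChainData V) (hPo₁ : P₁.o = c) (hPo₂ : P₂.o = c) (hPo₃ : P₃.o = c)
    (hPS₁ : P₁.Sfin = D.filter fun y => y ∈ graphBall G c L) (hPS₂ : P₂.Sfin = D.filter fun y => y ∈ graphBall G c L)
    (hPS₃ : P₃.Sfin = D.filter fun y => y ∈ graphBall G c L)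
    (hRim₁ : ∀ k, P₁.Rim k ⊆ (planarWindowWin (lip_rootFrame hlipφ c hσ) c L).stepDF (B.bridgeFrame hB) k)
    (hRim₂ : ∀ k, P₂.Rim k ⊆ (planarWindowWin hlip₂ c L).stepDF S₂ k) (hRim₃ : ∀ k, P₃.Rim k ⊆ (planarWindowWin hlip₃ c L).stepDF S₃ k)
    (hRl₁ : P₁.Rlev + 1 ≤ B.R') (hRl₂ : P₂.Rlev + 1 ≤ S₂.R') (hRl₃ : P₃.Rlev + 1 ≤ S₃.R') (hj₁ : P₁.j₁ ≤ P₁.Rlev) (hj₂ : P₂.j₁ ≤ P₂.Rlev)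
    (hj₃ : P₃.j₁ ≤ P₃.Rlev)
    -- rooms: footprints of the regions and of the last core, clearances, nonempty true targets, the two cross links
    (hfoot₁ : ∀ w ∈ graphBall G c L, rootFrame φ c σ w ∈ Finset.Icc B.regionLo B.regionHi → ψc w ∈ Pl)
    (hfoot₂ : ∀ k ≤ S₂.N, ∀ w ∈ graphBall G c L, ψ₂ w ∈ S₂.region k → ψc w ∈ Pl)
    (hfoot₃ : ∀ k ≤ S₃.N, ∀ w ∈ graphBall G c L, ψ₃ w ∈ S₃.region k → ψc w ∈ Pl)
    (hclear₁ : (kb : ℤ) < B.B₀lo 0 - B.R' - B.pr)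
    (hclear₂ : ∀ k ≤ S₂.N, ∀ w ∈ graphBall G c L, ψ₂ w ∈ S₂.region k → w ∉ S)
    (hclear₃ : ∀ k ≤ S₃.N, ∀ w ∈ graphBall G c L, ψ₃ w ∈ S₃.region k → w ∉ S)
    (hTne₁ : (Win G (rootFrame φ c σ) c (Finset.Icc B.core1Lo B.core1Hi) L).Nonempty)
    (hTne₂ : ∀ k ≤ S₂.N, (Win G ψ₂ c (S₂.core (k + 1)) L).Nonempty) (hTne₃ : ∀ k ≤ S₃.N, (Win G ψ₃ c (S₃.core (k + 1)) L).Nonempty)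
    (hx₁₂ : ∀ w ∈ graphBall G c L, rootFrame φ c σ w ∈ Finset.Icc B.core1Lo B.core1Hi → ψ₂ w ∈ S₂.core 0)
    (hx₂₃ : ∀ w ∈ graphBall G c L, ψ₂ w ∈ S₂.core (S₂.N + 1) → ψ₃ w ∈ S₃.core 0)
    (hlastf : ∀ w ∈ graphBall G c L, ψ₃ w ∈ S₃.core (S₃.N + 1) → w ∈ MM)
    -- the hop: a `P_q`-link inside `U ⊆ D ∩ B(c, L)` from a sub-seed `S₀ ⊆ S ⊆ U` into the landing box
    {U S₀ T₀ : Finset V} (hUD : U ⊆ D) (hUL : ∀ u ∈ U, u ∈ graphBall G c L) (hS₀ : S₀ ⊆ S) (hSU : S ⊆ U)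
    (hT₀ : ∀ w ∈ T₀, w ∈ graphBall G c L ∧ rootFrame φ c σ w ∈ Finset.Icc B.B₀lo B.B₀hi) {Δ' : ℕ} {δ ε η : ℝ}
    (hlink : 1 - δ < (bondPercolation G q).real (linkIn (↑U : Set V) S₀ T₀))
    -- the chain property of the inner window graph at `(δ ↦ ε)`, length `1 + (S₂.N + 1) + (S₃.N + 1)`
    (hchain : ∀ (W : Sym2 V → unitInterval) (s : Fin (0 + 1 + S₂.N + 1 + S₃.N + 1) → TStep (winGraph G c L))
      (T' : Fin (0 + 1 + S₂.N + 1 + S₃.N + 1) → Finset V) (η : ℝ),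
      (∀ i, (s i).L.o = (s 0).L.o) →
      (∀ i : Fin (0 + 1 + S₂.N + 1 + S₃.N), T' (Fin.castSucc i) ⊆ (s i.succ).L.X 0) →
      (∀ i, T' i ⊆ (s i).T) →
      (∀ i, (s i).KitsAt W q Δ' δ) →
      η ≤ δ / 2 →
      (∀ i, (prodBernoulli W).real (⋃ t ∈ (s i).T \ T' i, openConn (s 0).L.o t) ≤ η) →
      1 - δ < (prodBernoulli W).real (s 0).L.reachB →
        1 - ε < (prodBernoulli W).real (⋃ t ∈ T' (Fin.last (0 + 1 + S₂.N + 1 + S₃.N)), openConn (s 0).L.o t))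
    -- analytic inputs under the route law `routeW G Wt Qt S`, `Qt = D ∩ B(c, L)`: counts, kits, rim excess
    (hcount₁ : 1 / (1 - (q : ℝ)) ^ (Δ' * P₁.N) ≤ δ * ((Finset.Icc P₁.j₀ P₁.j₁).card : ℝ))
    (hcount₂ : 1 / (1 - (q : ℝ)) ^ (Δ' * P₂.N) ≤ δ * ((Finset.Icc P₂.j₀ P₂.j₁).card : ℝ))
    (hcount₃ : 1 / (1 - (q : ℝ)) ^ (Δ' * P₃.N) ≤ δ * ((Finset.Icc P₃.j₀ P₃.j₁).card : ℝ))
    (hkits₁ : SegKits (routeW G Wt (D.filter fun y => y ∈ graphBall G c L) S) q δ P₁ (planarWindowWin (lip_rootFrame hlipφ c hσ) c L)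
      (B.bridgeFrame hB))
    (hkits₂ : SegKits (routeW G Wt (D.filter fun y => y ∈ graphBall G c L) S) q δ P₂ (planarWindowWin hlip₂ c L) S₂)
    (hkits₃ : SegKits (routeW G Wt (D.filter fun y => y ∈ graphBall G c L) S) q δ P₃ (planarWindowWin hlip₃ c L) S₃)
    (hη : η ≤ δ / 2)
    (hexc₁ : ∀ k ≤ (B.bridgeFrame hB).N,
      (prodBernoulli (routeW G Wt (D.filter fun y => y ∈ graphBall G c L) S)).real (⋃ t' ∈ P₁.Rim k, openConn c t') ≤ η)
    (hexc₂ : ∀ k ≤ S₂.N, (prodBernoulli (routeW G Wt (D.filter fun y => y ∈ graphBall G c L) S)).real (⋃ t' ∈ P₂.Rim k, openConn c t') ≤ η)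
    (hexc₃ : ∀ k ≤ S₃.N, (prodBernoulli (routeW G Wt (D.filter fun y => y ∈ graphBall G c L) S)).real (⋃ t' ∈ P₃.Rim k, openConn c t') ≤ η) :
    ∃ Qt Ft : Finset V, Ft ⊆ T ∧ Qt ⊆ D ∧ Disjoint Ft Z ∧ 1 - ε < (prodBernoulli Wt).real (linkIn (↑Qt : Set V) S Ft) := by
  set Qt := D.filter fun y => y ∈ graphBall G c L with hQt
  set 𝒲₁ := planarWindowWin (lip_rootFrame hlipφ c hσ) c L with h𝒲₁
  set 𝒲₂ := planarWindowWin hlip₂ c L with h𝒲₂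
  set 𝒲₃ := planarWindowWin hlip₃ c L with h𝒲₃
  set S₁ := B.bridgeFrame hB with hS₁
  -- the inner ball lies in the outer ball
  have hball : ∀ {w : V}, w ∈ graphBall G c L → w ∈ graphBall G w₀ Rπ := by
    intro w hw
    have h2 := BoxProdZ2.mem_graphBall_add G hcL hw
    rwa [Nat.sub_add_cancel hLπ] at h2
  have hQD : Qt ⊆ D := Finset.filter_subset _ _
  have hQL : ∀ u ∈ Qt, u ∈ graphBall G c L := fun u hu => (Finset.mem_filter.1 hu).2
  have hW : ∀ {w : V}, w ∈ graphBall G c L → ψc w ∈ Pl → w ∈ Qt := by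
    intro w hw hf
    exact Finset.mem_filter.2 ⟨hPlD ((mem_Win G ψc).2 ⟨hball hw, hf⟩), hw⟩
  have hSQ : S ⊆ Qt := fun s hs => Finset.mem_filter.2 ⟨hSD hs, hSL s hs⟩
  -- regions: inside the world, off the seed
  have hDQ₁ : ∀ k ≤ S₁.N, 𝒲₁.stepDF S₁ k ⊆ Qt := by
    intro k hk w hw
    obtain rfl : k = 0 := Nat.le_zero.1 hk
    change w ∈ Win G (rootFrame φ c σ) c (S₁.region 0) L at hw
    rw [mem_Win] at hw
    exact hW hw.1 (hfoot₁ w hw.1 (by simpa [hS₁] using hw.2))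
  have hDQ₂ : ∀ k ≤ S₂.N, 𝒲₂.stepDF S₂ k ⊆ Qt := by
    intro k hk w hw
    change w ∈ Win G ψ₂ c (S₂.region k) L at hw
    rw [mem_Win] at hw
    exact hW hw.1 (hfoot₂ k hk w hw.1 hw.2)
  have hDQ₃ : ∀ k ≤ S₃.N, 𝒲₃.stepDF S₃ k ⊆ Qt := by
    intro k hk w hw
    change w ∈ Win G ψ₃ c (S₃.region k) L at hw
    rw [mem_Win] at hw
    exact hW hw.1 (hfoot₃ k hk w hw.1 hw.2)
  have hDS₁ : ∀ k ≤ S₁.N, Disjoint S (𝒲₁.stepDF S₁ k) := by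
    intro k hk
    obtain rfl : k = 0 := Nat.le_zero.1 hk
    change Disjoint S (Win G (rootFrame φ c σ) c (S₁.region 0) L)
    refine Finset.disjoint_left.2 fun w hwS hw => ?_
    rw [mem_Win] at hw
    have h1 : B.B₀lo 0 - B.R' - B.pr ≤ rootFrame φ c σ w 0 := BridgePrm.le_of_mem_region (by simpa [hS₁] using hw.2) 0
    have h2 := (abs_le.1 (hSk w hwS)).2
    linarith
  have hDS₂ : ∀ k ≤ S₂.N, Disjoint S (𝒲₂.stepDF S₂ k) := by
    intro k hk
    change Disjoint S (Win G ψ₂ c (S₂.region k) L)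
    refine Finset.disjoint_left.2 fun w hwS hw => ?_
    rw [mem_Win] at hw
    exact hclear₂ k hk w hw.1 hw.2 hwS
  have hDS₃ : ∀ k ≤ S₃.N, Disjoint S (𝒲₃.stepDF S₃ k) := by
    intro k hk
    change Disjoint S (Win G ψ₃ c (S₃.region k) L)
    refine Finset.disjoint_left.2 fun w hwS hw => ?_
    rw [mem_Win] at hw
    exact hclear₃ k hk w hw.1 hw.2 hwS
  -- nonempty true targets
  have hTne₁' : ∀ k ≤ S₁.N, (𝒲₁.coreTF S₁ k).Nonempty := by
    intro k hk
    obtain rfl : k = 0 := Nat.le_zero.1 hk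
    change (Win G (rootFrame φ c σ) c (S₁.core (0 + 1)) L).Nonempty
    simpa [hS₁] using hTne₁
  have hTne₂' : ∀ k ≤ S₂.N, (𝒲₂.coreTF S₂ k).Nonempty := fun k hk => hTne₂ k hk
  have hTne₃' : ∀ k ≤ S₃.N, (𝒲₃.coreTF S₃ k).Nonempty := fun k hk => hTne₃ k hk
  have hRl₁' : P₁.Rlev + 1 ≤ S₁.R' := by simpa [hS₁] using hRl₁
  -- the chain facts of the three segments under the route law
  have hF₁ := chainFacts_seg_routeW hWG hWD hDπ hQD hQL hSQ hcS 𝒲₁ S₁ P₁ hPo₁ hPS₁ hRl₁' hRim₁ hTne₁' hj₁ hDQ₁ hDS₁ hcount₁ hkits₁ hexc₁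
  have hF₂ := chainFacts_seg_routeW hWG hWD hDπ hQD hQL hSQ hcS 𝒲₂ S₂ P₂ hPo₂ hPS₂ hRl₂ hRim₂ hTne₂' hj₂ hDQ₂ hDS₂ hcount₂ hkits₂ hexc₂
  have hF₃ := chainFacts_seg_routeW hWG hWD hDπ hQD hQL hSQ hcS 𝒲₃ S₃ P₃ hPo₃ hPS₃ hRl₃ hRim₃ hTne₃' hj₃ hDQ₃ hDS₃ hcount₃ hkits₃ hexc₃
  -- the two cross links
  have hx₁ : 𝒲₁.coreTF S₁ S₁.N ⊆ (P₂.stepAF 𝒲₂ S₂ 0).L.X 0 := by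
    rw [show (P₂.stepAF 𝒲₂ S₂ 0).L.X 0 = (P₂.stepLF 𝒲₂ S₂ 0).X 0 from rfl, P₂.stepLF_X_zero]
    intro w hw
    change w ∈ Win G (rootFrame φ c σ) c (S₁.core (S₁.N + 1)) L at hw
    change w ∈ Win G ψ₂ c (S₂.core 0) L
    rw [mem_Win] at hw ⊢
    exact ⟨hw.1, hx₁₂ w hw.1 (by simpa [hS₁] using hw.2)⟩
  have hx₂ : 𝒲₂.coreTF S₂ S₂.N ⊆ (P₃.stepAF 𝒲₃ S₃ 0).L.X 0 := by
    rw [show (P₃.stepAF 𝒲₃ S₃ 0).L.X 0 = (P₃.stepLF 𝒲₃ S₃ 0).X 0 from rfl, P₃.stepLF_X_zero]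
    intro w hw
    change w ∈ Win G ψ₂ c (S₂.core (S₂.N + 1)) L at hw
    change w ∈ Win G ψ₃ c (S₃.core 0) L
    rw [mem_Win] at hw ⊢
    exact ⟨hw.1, hx₂₃ w hw.1 hw.2⟩
  -- append twice
  have hF₁₂ := hF₁.append hF₂ hx₁
  have hx₂' : pw S₁.N (fun k => 𝒲₁.coreTF S₁ k) (fun k => 𝒲₂.coreTF S₂ k) (S₁.N + 1 + S₂.N) ⊆ (P₃.stepAF 𝒲₃ S₃ 0).L.X 0 := by
    rw [ChainFacts.pw_last]; exact hx₂
  have hF := hF₁₂.append hF₃ hx₂'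
  -- the last true target and the hop's landing box
  have hlast : 𝒲₃.coreTF S₃ S₃.N ⊆ MM := by
    intro w hw
    change w ∈ Win G ψ₃ c (S₃.core (S₃.N + 1)) L at hw
    rw [mem_Win] at hw
    exact hlastf w hw.1 hw.2
  have hSF : Disjoint S (𝒲₃.coreTF S₃ S₃.N) := (hDS₃ S₃.N le_rfl).mono_right (𝒲₃.coreTF_subset_stepDF S₃ le_rfl)
  have hT₀' : T₀ ⊆ (pw (S₁.N + 1 + S₂.N) (pw S₁.N (fun k => P₁.stepAF 𝒲₁ S₁ k) (fun k => P₂.stepAF 𝒲₂ S₂ k))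
      (fun k => P₃.stepAF 𝒲₃ S₃ k) 0).L.X 0 := by
    rw [ChainFacts.pw_zero, ChainFacts.pw_zero, show (P₁.stepAF 𝒲₁ S₁ 0).L.X 0 = (P₁.stepLF 𝒲₁ S₁ 0).X 0 from rfl, P₁.stepLF_X_zero]
    intro w hw
    obtain ⟨hπ, hbox⟩ := hT₀ w hw
    change w ∈ Win G (rootFrame φ c σ) c (S₁.core 0) L
    rw [mem_Win]
    exact ⟨hπ, by simpa [hS₁] using hbox⟩
  have hTn : pw (S₁.N + 1 + S₂.N) (pw S₁.N (fun k => 𝒲₁.coreTF S₁ k) (fun k => 𝒲₂.coreTF S₂ k)) (fun k => 𝒲₃.coreTF S₃ k)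
      (S₁.N + 1 + S₂.N + 1 + S₃.N) ⊆ 𝒲₃.coreTF S₃ S₃.N := by
    rw [ChainFacts.pw_last]
  have hUQ : U ⊆ Qt := fun u hu => Finset.mem_filter.2 ⟨hUD hu, hUL u hu⟩
  have hN : S₁.N + 1 + S₂.N + 1 + S₃.N = 0 + 1 + S₂.N + 1 + S₃.N := by simp [hS₁]
  refine ⟨Qt, 𝒲₃.coreTF S₃ S₃.N, hlast.trans hMT, hQD, hMZ.mono_left hlast, ?_⟩
  exact linkIn_of_chainFacts hWD hDπ hQD hSQ hcS hSconn hF (hN ▸ hchain) hη hUQ hS₀ hSU hT₀' hlink hTn hSF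

end Skelφ

end Summit.CriticalPhenomena.PercolationContinuityZ3.Theorems.Transplant

end
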